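import Summits.QuantumFields.YangMills.Theorems.BalabanUVNodesN15SiteCurvedRightEntryLetters
import Summits.QuantumFields.YangMills.Theorems.BalabanUVNodesN15BackgroundMatrixByParts
import HarnessLib

/-!
# Route «BalabanUVNodes», cluster K4 «SpineRates» — node N15 = NE2: THE SITE LAYER WITH THE BACKGROUND LIVE IN THE TwoGrid ENTRY CURRENCY, XLV — THE SHIFT-DEFECT ROW LETTER OF
# THE CURVED KING FAMILY (dag-n15-e Σ-c's device `⊗` colour): through the colour-lifted one-step block map the defect of the two unit shifts composed with a translated coefficient
# multiplication and King's `Σ_ν (A₀⁻¹N∇*_ν ⊗ 1) pr_ν` is `≤ C·(o₁ + a₀(L^K)^{−α})·e^{−δ|y−y′|_T}` on the CLOSED mass range — dag-n15-c FILE 24's hypothesis `hDSh` at the curved King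
# family (part XLIV), reduced to the coefficient's rows `a₀` and one-step oscillation `o₁`

Cell `pub-ymgap`, WIDTH SEAT `pub-ymgap-dag-n15-w1` (generation 5; director-ym №197 ∕ HUMAN RULING D-0149, №219 (1); chair R455 (A) ∕ R461; dag-lead KEY MAP v2 INBOX l.35754;
the located sequel (o1) of dag-n15-e g15 INBOX l.39322 ∕ l.39620; dag-n15-d g18 l.40235 ∕ l.40918; CLAIM-10).  `bears_on: R4∕N15 · K3⁸ SpineGivenEndpointR13SepCoPHV
(stmt-QuantumFields-27366; K3⁷ 20544 aside = lineage)`.  Filed `--kind proof --supports stmt-QuantumFields-27366 --as helper` — COUNT-NEUTRAL.  THEOREMS ONLY (0 `def`,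
0 `sorry`).  Imports BY NAME part XLI `…N15SiteCurvedRightEntryLetters` (p649008: `kingGT_comp_curvSrcC`, `kingS_layer_massRange`, `continuousAt_kingSOp_mass`, `pull_liftEquiv_eq_tensorId`;
through it Σ-c `underPtN_add_unitVec`∕`hasMaj_oneStepFwd_kingSOp`∕`kingGOp_comp_fgradAdj`, Σ-a `hasMaj_exp_weaken`, Ω-a `castT`∕`underPtN_castT`∕`castT_add_unitVec`, VII
`hasMaj_ofBlocks_of_massLimit`, dag-n15-c `tensorId`∕`hasMaj_tensorId`, n15-c `sumJ`∕`hasMaj_sumJ_exp`∕`comp_sumJ`∕`sub_id_comp_comp_eq`∕`tdistT_blockOf_add_unitVec_le`, `SiteLayer.hasMaj_diagK_comp_exp`∕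
`hasMaj_add_exp`) and dag-n15-c FILE 12 `…N15BackgroundMatrixByParts` (`hasMaj_mmulOp_translate`, `hasMaj_mmulOp_sub_translate`, `pull_comp_mmulOp_translate'`); nothing in the tree is modified.

WHY.  Part XLIV (`ne2PlusOperator_curvKopBP_of_letters`) displays exactly two inputs of dag-n15-c FILE 24 at the curved King family: the coefficient bundle `TwoSidedLetters` (`hLt`) and
the shift-defect row letter `hDSh`.  The latter is dag-n15-e Σ-c ★★ `hasMaj_shiftDefect_kingS` — scalar lattice, King's point pairing `underPtN`, positive mass — while part XLIV needs it
on the colour product `Tor × κ`, through the one-step block map of the nested fine torus, at `m² = 0`, with the coefficient operator `C_a = M_{Â_μ∘τ_μ⁻¹}` (a MATRIX multiplication).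
THIS FILE re-runs Σ-c's device in that setting: §1 the nested one-step dichotomy (`blockOf L (z′ + e′_μ) = blockOf L z′` or `+ e_μ`, from Σ-c `underPtN_add_unitVec` through the cast);
§2 the device `⊗` colour (the defect of the two lifted shifts after `T` has every block majorant the one-step difference `(S_μ ⊗ 1 − 1)∘T` has) and the lifted shift cost; §3 Σ-c's
one-step Hölder letter `(S_μ − 1)A₀⁻¹N∇*_ν` `⊗ 1` on the closed mass range; §4 ★★ `curvShiftDefect_letter` — FILE 24's `hDSh` shape with `C_a = mmulOp (Â∘τ⁻¹)`, bound
`C·(o₁ + a₀(L^K)^{−α})·e^{−δd}` from the rows `a₀` and the one-step oscillation `o₁` of `Â` (n15-c FILE 12's letters) — so that part XLIV's `hDSh` follows from `hLt`'s clauses 2 and 13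
(the sequel, one corollary).

HONEST FRAMING ∕ LIMITS.  Count-neutral KNIT plumbing; no new estimate (inputs: W-b ∕ Ψ-e via Σ-c ∕ Σ-a, VII).  King's `A = 0` MODEL, `U ≡ 1` letters only; nothing of [B5]∕[B6]∕[B9]
asserted ((3.42)–(3.43) pp. 397–398, (3.64)–(3.65) p. 402 = SHAPES ∕ MECHANISM).  It does NOT discharge part XLIV's `hLt`; NE2⁺ NOT PRINTED ∕ NOT proved for d = 4; **N15 is NOT
discharged**; K3⁸ OPEN, not claimed, skeleton v6 untouched; counts of record UNMOVED (typed 28∕28 · discharged 5∕27, A 5∕28); one finite four-torus programme at fixed `ε` — NOT ℝ⁴, NOT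
infinite volume, NOT OS, NOT a mass gap, NOT Clay; R4 closes the conditional finite-𝕋⁴ rung `BalabanLadder.UV` only.  HONEST SCOPE: odd `L ≥ 3`, `a > 0`, cubes `2L^e`, `K ≥ 1`, one
blocking step, `0 ≤ m² ≤ m₀²`, `0 < α < 1`, sharp block sup sizes.  Restate-immune (no Theses import).
-/

set_option autoImplicit false

noncomputable section
open scoped BigOperators Matrix

namespace Summit.QuantumFields.YangMills.BalabanUVNodes.N15.SiteLayerBg

open Finset Filter
open Literature.MathematicalPhysics.QuantumFieldTheory.Balaban1983to89
open Literature.MathematicalPhysics.QuantumFieldTheory.Balaban1983to89.B11SectG (BlockNorm HasMaj)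
open Literature.MathematicalPhysics.QuantumFieldTheory.Balaban1983to89.B11AxialTransport190 (abs_le_loc_ofBlocks loc_ofBlocks_le)
open Literature.MathematicalPhysics.QuantumFieldTheory.Balaban1983to89.T4EtaRateDefect (idef idef_apply)
open Literature.MathematicalPhysics.QuantumFieldTheory.Balaban1983to89.T4EtaRateCoeffDefect (pull pull_apply diagK)
open Literature.MathematicalPhysics.QuantumFieldTheory.Balaban1983to89.B5Prop11Plancherel (Tor fine unitVec)
open Literature.MathematicalPhysics.QuantumFieldTheory.King1986.Torus (blockOf tdistT tdistT_nonneg tdistT_symm tdistT_triangle)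
open Summit.QuantumFields.YangMills.BalabanUVNodes.N15.VectorPiece (unitTorusGeoS tensorId tensorId_apply hasMaj_tensorId)
open Summit.QuantumFields.YangMills.BalabanUVNodes.N15.MatrixSpecies (mmulOp liftMap liftBlk liftEquiv liftEquiv_apply)
open Summit.QuantumFields.YangMills.BalabanUVNodes.N15.BackgroundLayer (fgradAdj sumJ hasMaj_sumJ_exp comp_sumJ sub_id_comp_comp_eq tdistT_blockOf_add_unitVec_le
  hasMaj_mmulOp_translate hasMaj_mmulOp_sub_translate pull_comp_mmulOp_translate')
open Summit.QuantumFields.YangMills.BalabanUVNodes.N15.SiteLayer (hasMaj_diagK_comp_exp hasMaj_add_exp)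
open Summit.QuantumFields.YangMills.BalabanUVNodes.N15.CurvedSpecies (torStep)
open Summit.QuantumFields.YangMills.BalabanUVNodes.N15KingModelRung (KingVolIndex)
open Summit.QuantumFields.YangMills.BalabanUVNodes.N15KingModelRung.Curved

variable {d : ℕ} (L : ℕ) [NeZero L]
variable (κ : Type) [Fintype κ] [DecidableEq κ] (a : ℝ)

/-! ## §1 The nested one-step dichotomy -/

section Dichotomy

variable (K : ℕ) (M : Fin (d + 1) → ℕ) [∀ μ, NeZero (M μ)]

omit [Fintype κ] [DecidableEq κ] in
/-- One nested fine step forward lands under the SAME coarse point or under the NEXT one in that direction (Σ-c `underPtN_add_unitVec` read through Ω-a's cast). [cite: King1986, p.664 (pairing convention)] -/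
theorem blockOf_add_unitVec_nested (z' : Tor (fine L (fine (L ^ K) M))) (μ : Fin (d + 1)) :
    blockOf L (fine (L ^ K) M) (z' + unitVec (fine L (fine (L ^ K) M)) μ) = blockOf L (fine (L ^ K) M) z' ∨
      blockOf L (fine (L ^ K) M) (z' + unitVec (fine L (fine (L ^ K) M)) μ) = blockOf L (fine (L ^ K) M) z' + unitVec (fine (L ^ K) M) μ := by
  rw [← underPtN_castT L K M z', ← underPtN_castT L K M (z' + _), castT_add_unitVec]
  exact underPtN_add_unitVec L K 1 M (castT L K M z') μ

end Dichotomy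

/-! ## §2 Σ-c's device `⊗` colour: the defect of the two lifted unit shifts, and the lifted shift cost -/

section Device

variable (K : ℕ) (M : Fin (d + 1) → ℕ) [∀ μ, NeZero (M μ)] (Msz : ℝ)

omit [DecidableEq κ] in
/-- ★ **THE DEFECT OF THE TWO LIFTED UNIT SHIFTS IS MAJORISED BY THE ONE-STEP DIFFERENCE** (Σ-c `hasMaj_idefShiftT_comp` `⊗` colour, nested fine torus, one-step block map): if
`(S_μ ⊗ 1 − 1)∘T ≤ K_f` (`K_f ≥ 0`) into the coloured coarse cubes, then `𝔇(S′_μ ⊗ 1, S_μ ⊗ 1)∘T ≤ K_f` into the coloured nested fine cubes — the defect vanishes where the fine step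
stays under its coarse point and is minus the one-step difference where it crosses. [cite: King1986, p.664 (pairing: the mechanism); Balaban1985BackgroundPropagators, (3.64)–(3.65) p.402 (one-site shifts)] -/
theorem hasMaj_idefShiftT_comp_col {F₁ : Type} [AddCommGroup F₁] [Module ℝ F₁] {b₁ : BlockNorm (unitTorusGeoS L K M Msz) F₁}
    {T : F₁ →ₗ[ℝ] (Tor (fine (L ^ K) M) × κ → ℝ)} {Kf : Tor M → Tor M → ℝ} (hK : ∀ y y', 0 ≤ Kf y y') (μ : Fin (d + 1))
    (h : HasMaj b₁ (BlockNorm.ofBlocks (unitTorusGeoS L K M Msz) (liftBlk (blockOf (L ^ K) M) κ))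
      ((pull ⇑(liftEquiv (torStep (fine (L ^ K) M) μ) κ) - LinearMap.id) ∘ₗ T) Kf) :
    HasMaj b₁ (BlockNorm.ofBlocks (unitTorusGeoS L K M Msz) (liftBlk (blockOf (L ^ K) M ∘ blockOf L (fine (L ^ K) M)) κ))
      (idef (pull (liftMap (blockOf L (fine (L ^ K) M)) κ)) (pull (liftMap (blockOf L (fine (L ^ K) M)) κ))
        (pull ⇑(liftEquiv (torStep (fine L (fine (L ^ K) M)) μ) κ)) (pull ⇑(liftEquiv (torStep (fine (L ^ K) M) μ) κ)) ∘ₗ T) Kf := by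
  intro y' v hv y
  refine loc_ofBlocks_le (g := unitTorusGeoS L K M Msz) _ _ (mul_nonneg (hK y y') (b₁.loc_nonneg y' v)) fun p hp => ?_
  have hval : (idef (pull (liftMap (blockOf L (fine (L ^ K) M)) κ)) (pull (liftMap (blockOf L (fine (L ^ K) M)) κ))
        (pull ⇑(liftEquiv (torStep (fine L (fine (L ^ K) M)) μ) κ)) (pull ⇑(liftEquiv (torStep (fine (L ^ K) M) μ) κ)) ∘ₗ T) v p =
      T v (blockOf L (fine (L ^ K) M) (p.1 + unitVec (fine L (fine (L ^ K) M)) μ), p.2) - T v (blockOf L (fine (L ^ K) M) p.1 + unitVec (fine (L ^ K) M) μ, p.2) := by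
    simp only [LinearMap.comp_apply, idef_apply, Pi.sub_apply, pull_apply, liftEquiv_apply, torStep, Equiv.coe_addRight, kingTorusLine_unitVec_eq]
  rw [hval]
  have hp' : blockOf (L ^ K) M (blockOf L (fine (L ^ K) M) p.1) = y := hp
  rcases blockOf_add_unitVec_nested L K M p.1 μ with hc | hc
  · -- inside: minus the one-step difference at the paired point
    rw [hc]
    have hval2 : T v (blockOf L (fine (L ^ K) M) p.1, p.2) - T v (blockOf L (fine (L ^ K) M) p.1 + unitVec (fine (L ^ K) M) μ, p.2) =
        -((((pull ⇑(liftEquiv (torStep (fine (L ^ K) M) μ) κ) - LinearMap.id) ∘ₗ T : F₁ →ₗ[ℝ] (Tor (fine (L ^ K) M) × κ → ℝ)) v)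
          (blockOf L (fine (L ^ K) M) p.1, p.2)) := by
      simp only [LinearMap.comp_apply, LinearMap.sub_apply, Pi.sub_apply, pull_apply, liftEquiv_apply, torStep, Equiv.coe_addRight, kingTorusLine_unitVec_eq,
        LinearMap.id_apply, neg_sub]
    rw [hval2, abs_neg]
    exact (abs_le_loc_ofBlocks (g := unitTorusGeoS L K M Msz) (liftBlk (blockOf (L ^ K) M) κ) _ (x' := (blockOf L (fine (L ^ K) M) p.1, p.2)) hp').trans (h y' v hv y)
  · -- on the face: the two shifts are paired, the defect vanishes
    rw [hc, sub_self, abs_zero]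
    exact mul_nonneg (hK y y') (b₁.loc_nonneg y' v)

omit [NeZero L] [DecidableEq κ] in
/-- Composing with a lifted unit shift costs `e^{ρ}`: `(S_μ ⊗ 1)∘T ≤ B·e^{ρ}·e^{−ρ|y−y′|_T}` if `T ≤ B·e^{−ρ|y−y′|_T}` into the coloured cubes of fineness `N` (Σ-c `hasMaj_shiftT_comp` `⊗` colour).
[cite: King1986, p.664 (unit blocks)] -/
theorem hasMaj_shiftT_comp_col (N : ℕ) [NeZero N] {F₁ : Type} [AddCommGroup F₁] [Module ℝ F₁] {b₁ : BlockNorm (unitTorusGeoS L K M Msz) F₁}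
    {T : F₁ →ₗ[ℝ] (Tor (fine N M) × κ → ℝ)} {B ρ : ℝ} (hB : 0 ≤ B) (hρ : 0 ≤ ρ) (μ : Fin (d + 1))
    (h : HasMaj b₁ (BlockNorm.ofBlocks (unitTorusGeoS L K M Msz) (liftBlk (blockOf N M) κ)) T (fun y y' => B * Real.exp (-(ρ * tdistT M y y')))) :
    HasMaj b₁ (BlockNorm.ofBlocks (unitTorusGeoS L K M Msz) (liftBlk (blockOf N M) κ)) (pull ⇑(liftEquiv (torStep (fine N M) μ) κ) ∘ₗ T)
      (fun y y' => B * Real.exp ρ * Real.exp (-(ρ * tdistT M y y'))) := by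
  intro y' v hv y
  refine loc_ofBlocks_le (g := unitTorusGeoS L K M Msz) _ _ (mul_nonneg (by positivity) (b₁.loc_nonneg y' v)) fun p hp => ?_
  rw [LinearMap.comp_apply, pull_apply, liftEquiv_apply]
  simp only [torStep, Equiv.coe_addRight, kingTorusLine_unitVec_eq]
  set y₁ := blockOf N M (p.1 + unitVec (fine N M) μ) with hy₁
  have h1 : |T v (p.1 + unitVec (fine N M) μ, p.2)| ≤ B * Real.exp (-(ρ * tdistT M y₁ y')) * b₁.loc y' v :=
    (abs_le_loc_ofBlocks (g := unitTorusGeoS L K M Msz) (liftBlk (blockOf N M) κ) _ (x' := (p.1 + unitVec (fine N M) μ, p.2)) rfl).trans (h y' v hv y₁)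
  have hp' : blockOf N M p.1 = y := hp
  have hd : tdistT M y y' ≤ tdistT M y₁ y' + 1 := by
    have h2 : tdistT M y y₁ ≤ 1 := by
      rw [← hp', hy₁, tdistT_symm]
      exact tdistT_blockOf_add_unitVec_le M N p.1 μ
    linarith [tdistT_triangle M y y₁ y']
  refine h1.trans (mul_le_mul_of_nonneg_right ?_ (b₁.loc_nonneg y' v))
  show B * Real.exp (-(ρ * tdistT M y₁ y')) ≤ B * Real.exp ρ * Real.exp (-(ρ * tdistT M y y'))
  rw [mul_assoc, ← Real.exp_add]
  exact mul_le_mul_of_nonneg_left (Real.exp_le_exp.mpr (by nlinarith)) hB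

end Device

/-! ## §3 Σ-c's one-step Hölder letter `⊗ 1` on the closed mass range -/

section OneStep

omit [NeZero L] [Fintype κ] [DecidableEq κ] in
/-- `(S ⊗ 1 − 1) ∘ (T ⊗ 1) = ((S − 1) ∘ T) ⊗ 1`. [folklore] -/
theorem pullSub_comp_tensorId {Y : Type} (s : Y ≃ Y) (T : (Y → ℝ) →ₗ[ℝ] (Y → ℝ)) :
    (pull ⇑(liftEquiv s κ) - LinearMap.id) ∘ₗ tensorId κ T = tensorId κ ((pull (⇑s : Y → Y) - LinearMap.id) ∘ₗ T) := by
  refine LinearMap.ext fun f => funext fun p => ?_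
  simp only [LinearMap.comp_apply, LinearMap.sub_apply, Pi.sub_apply, pull_apply, liftEquiv_apply, LinearMap.id_apply, tensorId_apply]

omit [DecidableEq κ] in
/-- ★ **THE ONE-STEP HÖLDER LETTER OF THE RIGHT ENTRY, `⊗ 1`, ON `0 ≤ m² ≤ m₀²`** (Σ-c `hasMaj_oneStepFwd_kingSOp` on `(0, m₀² + 1]`, at `m² = 0` by part VII's limit device and part XLI's
continuity): `(S_μ ⊗ 1 − 1) ∘ (G ⊗ 1) ∘ curvSrcC ν ≤ C(L^K)^{−α}e^{−δ|y−y′|_T}` for every index, mass in the closed range and directions `μ, ν` (`0 < α < 1`).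
[cite: Balaban1985BackgroundPropagators, Thm 3.1 (3.43) p.398 (second half: shape); Balaban1984PropagatorsI, Prop. 1.2 (1.111) p.35; King1986, (4.1)–(4.5) p.670] -/
theorem curvOneStep_letter_massRange (hLodd : Odd L) (hL : 2 ≤ L) (ha : 0 < a) {m0sq : ℝ} (hm0 : 0 ≤ m0sq) {α : ℝ} (hα0 : 0 < α) (hα1 : α < 1) :
    ∃ C δ : ℝ, 0 < C ∧ 0 < δ ∧ ∀ (i : KingVolIndex d) (msq : ℝ), 0 ≤ msq → msq ≤ m0sq → ∀ μ ν : Fin (d + 1),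
      HasMaj (BlockNorm.ofBlocks (unitTorusGeoS L i.K (curvCube L i) i.Msz) (liftBlk (blockOf (L ^ i.K) (curvCube L i)) κ))
        (BlockNorm.ofBlocks (unitTorusGeoS L i.K (curvCube L i) i.Msz) (liftBlk (blockOf (L ^ i.K) (curvCube L i)) κ))
        ((pull ⇑(liftEquiv (torStep (fine (L ^ i.K) (curvCube L i)) μ) κ) - LinearMap.id) ∘ₗ (kingGT L a msq i.K (curvCube L i) κ ∘ₗ curvSrcC L κ i ν))
        (fun y y' => C * ((L : ℝ) ^ i.K) ^ (-α) * Real.exp (-(δ * tdistT (curvCube L i) y y'))) := by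
  obtain ⟨C, δ, hC, hδ, H⟩ := hasMaj_oneStepFwd_kingSOp (d := d) L hLodd hL ha (show (0 : ℝ) ≤ m0sq + 1 by linarith) hα0 hα1
  refine ⟨C, δ, hC, hδ, fun i msq hmsq hcap μ ν => ?_⟩
  have hLr : (0 : ℝ) ≤ (L : ℝ) := Nat.cast_nonneg _
  have maj0 : ∀ y y' : Tor (curvCube L i), 0 ≤ C * ((L : ℝ) ^ i.K) ^ (-α) * Real.exp (-(δ * tdistT (curvCube L i) y y')) :=
    fun _ _ => mul_nonneg (mul_nonneg hC.le (Real.rpow_nonneg (pow_nonneg hLr _) _)) (Real.exp_nonneg _)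
  rw [kingGT_comp_curvSrcC, pullSub_comp_tensorId]
  refine hasMaj_tensorId κ maj0 ?_
  -- the scalar letter on the closed mass range
  have hL1 : 1 < L := by omega
  have hm1 : (0 : ℝ) < m0sq + 1 := by linarith
  have HK := fun (m2 : ℝ) (hm2 : 0 < m2) (hcap2 : m2 ≤ m0sq + 1) => H i.K i.one_le_K i.m (curvCube L i) (fun _ => rfl) m2 hm2 hcap2 i.Msz μ ν
  rcases hmsq.lt_or_eq with hpos | h0
  · exact HK msq hpos (by linarith)
  · subst h0
    refine hasMaj_ofBlocks_of_massLimit (g := unitTorusGeoS L i.K (curvCube L i) i.Msz) (blockOf (L ^ i.K) (curvCube L i)) (blockOf (L ^ i.K) (curvCube L i))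
      (fun m2 => (pull ⇑(Equiv.addRight (unitVec (fine (L ^ i.K) (curvCube L i)) μ)) - LinearMap.id) ∘ₗ kingSOp L a m2 i.K (L ^ i.K) (curvCube L i) ν) _ hm1
      (fun lam x => ?_) (fun m2 hm2 hcap2 => HK m2 hm2 hcap2)
    simp only [LinearMap.comp_apply, LinearMap.sub_apply, Pi.sub_apply, pull_apply, LinearMap.id_apply]
    exact (continuousAt_kingSOp_mass L a (curvCube L i) (L ^ i.K) hL1 ha i.one_le_K ν lam _).sub (continuousAt_kingSOp_mass L a (curvCube L i) (L ^ i.K) hL1 ha i.one_le_K ν lam x)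

end OneStep

/-! ## §4 ★★ The shift-defect row letter of the curved King family (FILE 24's `hDSh` shape) -/

section Row

omit [DecidableEq κ] in
/-- ★★ **THE SHIFT-DEFECT ROW LETTER `⊗` COLOUR ON THE CLOSED MASS RANGE** (dag-n15-e Σ-c ★★ `hasMaj_shiftDefect_kingS` in part XLIV's setting): for odd `L ≥ 3`, `a > 0`, `m₀² ≥ 0`,
`0 < α < 1` there are `δ, C > 0` such that for every index `i`, mass `0 ≤ m² ≤ m₀²`, direction `μ`, coefficient `Â : Tor → Matrix κ κ ℝ` with rows `≤ a₀` and one-step oscillation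
`Σ_j |Â(x) − Â(τ_μ⁻¹x)|_{ij} ≤ o₁` (`a₀, o₁ ≥ 0`):
`𝔇(S′_μ ⊗ 1, S_μ ⊗ 1) ∘ (M_{Â∘τ_μ⁻¹} ∘ Σ_ν ((G ⊗ 1) ∘ N∇*_ν ⊗ 1) pr_ν) ≤ C·(o₁ + a₀(L^K)^{−α})·e^{−δ|y−y′|_T}` from the `J`-lifted coloured coarse cubes to the coloured nested fine cubes.
Content: §2's device; `(S_μ − 1)M_{Â∘τ⁻¹}Σ = (M_Â − M_{Â∘τ⁻¹})S_μΣ + M_{Â∘τ⁻¹}(S_μ − 1)Σ` (n15-c `sub_id_comp_comp_eq`, FILE 12 `pull_comp_mmulOp_translate'`); the first term costs the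
oscillation letter × the plain right-entry letter (part XLI) × the shift cost, the second the rows × §3's Hölder letter.
[cite: Balaban1985BackgroundPropagators, Thm 3.1 (3.42)–(3.43) pp.397–398, (3.64)–(3.65) p.402 (mechanism); King1986, p.664 (pairing); Balaban1984PropagatorsI, Prop. 1.2 (1.110)–(1.111) p.35 (shape)] -/
theorem curvShiftDefect_letter (hLodd : Odd L) (hL : 2 ≤ L) (ha : 0 < a) {m0sq : ℝ} (hm0 : 0 ≤ m0sq) {α : ℝ} (hα0 : 0 < α) (hα1 : α < 1) :
    ∃ δ C : ℝ, 0 < δ ∧ 0 < C ∧ ∀ (i : KingVolIndex d) (msq : ℝ), 0 ≤ msq → msq ≤ m0sq → ∀ (μ : Fin (d + 1)) (A : Tor (fine (L ^ i.K) (curvCube L i)) → Matrix κ κ ℝ)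
      (a₀ o₁ : ℝ), 0 ≤ a₀ → 0 ≤ o₁ → (∀ x c, ∑ j, |A x c j| ≤ a₀) → (∀ x c, ∑ j, |A x c j - A ((torStep (fine (L ^ i.K) (curvCube L i)) μ).symm x) c j| ≤ o₁) →
      HasMaj (BlockNorm.ofBlocks (unitTorusGeoS L i.K (curvCube L i) i.Msz) (liftBlk (liftBlk (blockOf (L ^ i.K) (curvCube L i)) κ) (Fin (d + 1))))
        (BlockNorm.ofBlocks (unitTorusGeoS L i.K (curvCube L i) i.Msz) (liftBlk (blockOf (L ^ i.K) (curvCube L i) ∘ blockOf L (fine (L ^ i.K) (curvCube L i))) κ))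
        (idef (pull (liftMap (blockOf L (fine (L ^ i.K) (curvCube L i))) κ)) (pull (liftMap (blockOf L (fine (L ^ i.K) (curvCube L i))) κ))
            (pull ⇑(liftEquiv (torStep (fine L (fine (L ^ i.K) (curvCube L i))) μ) κ)) (pull ⇑(liftEquiv (torStep (fine (L ^ i.K) (curvCube L i)) μ) κ)) ∘ₗ
          (mmulOp (A ∘ ⇑(torStep (fine (L ^ i.K) (curvCube L i)) μ).symm) ∘ₗ
            sumJ fun ν => kingGT L a msq i.K (curvCube L i) κ ∘ₗ fgradAdj ((L : ℝ) ^ i.K) (liftEquiv (torStep (fine (L ^ i.K) (curvCube L i)) ν) κ)))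
        (fun y y' => C * (o₁ + a₀ * ((L : ℝ) ^ i.K) ^ (-α)) * Real.exp (-(δ * tdistT (curvCube L i) y y'))) := by
  obtain ⟨C₁, δ₁, hC₁, hδ₁, HH⟩ := curvOneStep_letter_massRange (d := d) L κ a hLodd hL ha hm0 hα0 hα1
  obtain ⟨C₀, δ₀, m₀, hC₀, hδ₀, -, H0⟩ := kingS_layer_massRange (d := d) L a hLodd hL ha hm0 le_rfl zero_lt_one
  set δ : ℝ := min δ₀ δ₁ with hδdef
  have hδ : 0 < δ := lt_min hδ₀ hδ₁
  set C : ℝ := Real.exp δ * ((d + 1 : ℕ) * C₀) + (d + 1 : ℕ) * C₁ with hCdef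
  have hC : 0 < C := by positivity
  refine ⟨δ, C, hδ, hC, fun i msq hmsq hcap μ A a₀ o₁ ha₀ ho₁ hA hOscA => ?_⟩
  have hLr : (0 : ℝ) ≤ (L : ℝ) := Nat.cast_nonneg _
  have hrα : 0 ≤ ((L : ℝ) ^ i.K) ^ (-α) := Real.rpow_nonneg (pow_nonneg hLr _) _
  -- the plain right-entry letter `⊗ 1` at the common rate, `Σ`, and `(S_μ ⊗ 1)Σ`
  have hS : ∀ ν, HasMaj (BlockNorm.ofBlocks (unitTorusGeoS L i.K (curvCube L i) i.Msz) (liftBlk (blockOf (L ^ i.K) (curvCube L i)) κ))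
      (BlockNorm.ofBlocks (unitTorusGeoS L i.K (curvCube L i) i.Msz) (liftBlk (blockOf (L ^ i.K) (curvCube L i)) κ))
      (kingGT L a msq i.K (curvCube L i) κ ∘ₗ fgradAdj ((L : ℝ) ^ i.K) (liftEquiv (torStep (fine (L ^ i.K) (curvCube L i)) ν) κ))
      (fun y y' => C₀ * Real.exp (-(δ * tdistT (curvCube L i) y y'))) := fun ν => by
    have h := (H0 i.K i.one_le_K i.m (curvCube L i) (fun _ => rfl) msq hmsq hcap i.Msz ν).1
    have maj0 : ∀ y y' : Tor (curvCube L i), 0 ≤ C₀ * Real.exp (-(δ₀ * tdistT (curvCube L i) y y')) := fun _ _ => by positivity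
    have h' := hasMaj_tensorId κ maj0 h
    rw [← kingGT_comp_curvSrcC] at h'
    exact hasMaj_exp_weaken L hC₀.le le_rfl (min_le_left δ₀ δ₁) h'
  have hSig := hasMaj_sumJ_exp (g := unitTorusGeoS L i.K (curvCube L i) i.Msz) (liftBlk (blockOf (L ^ i.K) (curvCube L i)) κ)
    (b₂ := BlockNorm.ofBlocks (unitTorusGeoS L i.K (curvCube L i) i.Msz) (liftBlk (blockOf (L ^ i.K) (curvCube L i)) κ)) hC₀.le hS
  have hSsig := hasMaj_shiftT_comp_col L κ i.K (curvCube L i) i.Msz (L ^ i.K)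
    (b₁ := BlockNorm.ofBlocks (unitTorusGeoS L i.K (curvCube L i) i.Msz) (liftBlk (liftBlk (blockOf (L ^ i.K) (curvCube L i)) κ) (Fin (d + 1))))
    (mul_nonneg (Nat.cast_nonneg _) hC₀.le) hδ.le μ hSig
  -- term A: `(M_Â − M_{Â∘τ⁻¹}) (S ⊗ 1) Σ ≤ o₁·|J|C₀e^{δ}·e^{−δd}`
  have hOsc : HasMaj (BlockNorm.ofBlocks (unitTorusGeoS L i.K (curvCube L i) i.Msz) (liftBlk (blockOf (L ^ i.K) (curvCube L i)) κ))
      (BlockNorm.ofBlocks (unitTorusGeoS L i.K (curvCube L i) i.Msz) (liftBlk (blockOf (L ^ i.K) (curvCube L i)) κ))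
      (mmulOp A - mmulOp (A ∘ ⇑(torStep (fine (L ^ i.K) (curvCube L i)) μ).symm)) (diagK fun _ => o₁) :=
    hasMaj_mmulOp_sub_translate (g := unitTorusGeoS L i.K (curvCube L i) i.Msz) (blockOf (L ^ i.K) (curvCube L i)) (τ := torStep (fine (L ^ i.K) (curvCube L i))) (A := fun _ : Fin (d + 1) => A) μ ho₁ (fun x c => hOscA x c)
  have hA' := hasMaj_diagK_comp_exp (b₁ := BlockNorm.ofBlocks (unitTorusGeoS L i.K (curvCube L i) i.Msz) (liftBlk (liftBlk (blockOf (L ^ i.K) (curvCube L i)) κ) (Fin (d + 1))))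
    (b₃ := BlockNorm.ofBlocks (unitTorusGeoS L i.K (curvCube L i) i.Msz) (liftBlk (blockOf (L ^ i.K) (curvCube L i)) κ)) (liftBlk (blockOf (L ^ i.K) (curvCube L i)) κ) ho₁ hOsc hSsig
  -- term B: `M_{Â∘τ⁻¹} (S ⊗ 1 − 1) Σ ≤ a₀·|J|C₁(L^K)^{−α}·e^{−δd}`
  have hCa : HasMaj (BlockNorm.ofBlocks (unitTorusGeoS L i.K (curvCube L i) i.Msz) (liftBlk (blockOf (L ^ i.K) (curvCube L i)) κ))
      (BlockNorm.ofBlocks (unitTorusGeoS L i.K (curvCube L i) i.Msz) (liftBlk (blockOf (L ^ i.K) (curvCube L i)) κ))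
      (mmulOp (A ∘ ⇑(torStep (fine (L ^ i.K) (curvCube L i)) μ).symm)) (diagK fun _ => a₀) :=
    hasMaj_mmulOp_translate (g := unitTorusGeoS L i.K (curvCube L i) i.Msz) (blockOf (L ^ i.K) (curvCube L i)) (τ := torStep (fine (L ^ i.K) (curvCube L i))) (A := fun _ : Fin (d + 1) => A) ha₀ (fun _ x c => hA x c) μ
  have hstep : ∀ ν, HasMaj (BlockNorm.ofBlocks (unitTorusGeoS L i.K (curvCube L i) i.Msz) (liftBlk (blockOf (L ^ i.K) (curvCube L i)) κ))
      (BlockNorm.ofBlocks (unitTorusGeoS L i.K (curvCube L i) i.Msz) (liftBlk (blockOf (L ^ i.K) (curvCube L i)) κ))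
      ((pull ⇑(liftEquiv (torStep (fine (L ^ i.K) (curvCube L i)) μ) κ) - LinearMap.id) ∘ₗ
        (kingGT L a msq i.K (curvCube L i) κ ∘ₗ fgradAdj ((L : ℝ) ^ i.K) (liftEquiv (torStep (fine (L ^ i.K) (curvCube L i)) ν) κ)))
      (fun y y' => C₁ * ((L : ℝ) ^ i.K) ^ (-α) * Real.exp (-(δ * tdistT (curvCube L i) y y'))) := fun ν => by
    have h := HH i msq hmsq hcap μ ν
    rw [curvSrcC] at h
    exact hasMaj_exp_weaken L (mul_nonneg hC₁.le hrα) le_rfl (min_le_right δ₀ δ₁) h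
  have hSig' := hasMaj_sumJ_exp (g := unitTorusGeoS L i.K (curvCube L i) i.Msz) (liftBlk (blockOf (L ^ i.K) (curvCube L i)) κ)
    (b₂ := BlockNorm.ofBlocks (unitTorusGeoS L i.K (curvCube L i) i.Msz) (liftBlk (blockOf (L ^ i.K) (curvCube L i)) κ)) (mul_nonneg hC₁.le hrα) hstep
  have hSig'' := hSig'.congr fun u => (LinearMap.congr_fun (comp_sumJ (pull ⇑(liftEquiv (torStep (fine (L ^ i.K) (curvCube L i)) μ) κ) - LinearMap.id)
    (fun ν => kingGT L a msq i.K (curvCube L i) κ ∘ₗ fgradAdj ((L : ℝ) ^ i.K) (liftEquiv (torStep (fine (L ^ i.K) (curvCube L i)) ν) κ))) u).symm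
  have hB := hasMaj_diagK_comp_exp (b₁ := BlockNorm.ofBlocks (unitTorusGeoS L i.K (curvCube L i) i.Msz) (liftBlk (liftBlk (blockOf (L ^ i.K) (curvCube L i)) κ) (Fin (d + 1))))
    (b₃ := BlockNorm.ofBlocks (unitTorusGeoS L i.K (curvCube L i) i.Msz) (liftBlk (blockOf (L ^ i.K) (curvCube L i)) κ)) (liftBlk (blockOf (L ^ i.K) (curvCube L i)) κ) ha₀ hCa hSig''
  have hkey : o₁ * (((Fintype.card (Fin (d + 1)) : ℕ) : ℝ) * C₀ * Real.exp δ) + a₀ * (((Fintype.card (Fin (d + 1)) : ℕ) : ℝ) * (C₁ * ((L : ℝ) ^ i.K) ^ (-α))) ≤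
      C * (o₁ + a₀ * ((L : ℝ) ^ i.K) ^ (-α)) := by
    rw [Fintype.card_fin, hCdef]
    have h1 : 0 ≤ ((d + 1 : ℕ) : ℝ) * C₁ * o₁ := by positivity
    have h2 : 0 ≤ Real.exp δ * (((d + 1 : ℕ) : ℝ) * C₀) * (a₀ * ((L : ℝ) ^ i.K) ^ (-α)) := by positivity
    nlinarith
  have hsum := (hasMaj_add_exp hA' hB).mono fun y y' => (mul_le_mul_of_nonneg_right hkey (Real.exp_nonneg (-(δ * tdistT (curvCube L i) y y'))))
  -- the device: majorise `(S_μ ⊗ 1 − 1) ∘ (C_a ∘ Σ) = (C_a⁺ − C_a)(S_μ ⊗ 1)Σ + C_a(S_μ ⊗ 1 − 1)Σ`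
  have hCaS : pull ⇑(liftEquiv (torStep (fine (L ^ i.K) (curvCube L i)) μ) κ) ∘ₗ mmulOp (A ∘ ⇑(torStep (fine (L ^ i.K) (curvCube L i)) μ).symm) =
      mmulOp A ∘ₗ pull ⇑(liftEquiv (torStep (fine (L ^ i.K) (curvCube L i)) μ) κ) :=
    pull_comp_mmulOp_translate' (τ := torStep (fine (L ^ i.K) (curvCube L i))) (A := fun _ : Fin (d + 1) => A) μ
  exact hasMaj_idefShiftT_comp_col L κ i.K (curvCube L i) i.Msz
    (b₁ := BlockNorm.ofBlocks (unitTorusGeoS L i.K (curvCube L i) i.Msz) (liftBlk (liftBlk (blockOf (L ^ i.K) (curvCube L i)) κ) (Fin (d + 1))))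
    (fun _ _ => mul_nonneg (mul_nonneg hC.le (by positivity)) (Real.exp_nonneg _)) μ
    (hsum.congr fun u => (LinearMap.congr_fun (sub_id_comp_comp_eq _ _ _ _ hCaS) u).symm)

end Row

end Summit.QuantumFields.YangMills.BalabanUVNodes.N15.SiteLayerBg

end
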